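import Summits.BirchSwinnertonDyer.BirchSwinnertonDyer.Theorems.AlignedTransportAtTwoMainConjectureOfRankZeroBSDAtTwoFineRoadInfRes
import Summits.BirchSwinnertonDyer.BirchSwinnertonDyer.Theorems.AlignedTransportAtTwoMainConjectureOfRankZeroBSDAtTwoFineRoadRelaxedFine
import Literature.NumberTheory.GaloisRepresentations.ArchimedeanLocalDuality
import Literature.NumberTheory.GaloisRepresentations.CyclotomicCharacterSurjectiveProofs
import Mathlib.RingTheory.RootsOfUnity.AlgebraicallyClosed
import HarnessLib

/-!
# Road (b″) netted, descent step (ii): the RELAXED-at-`∞` Selmer and fine Selmer groups of `K_∞^{cyc}` restrict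
# into Kato's tower `K(μ_{p^∞})` — «no real place upstairs» as a kernel theorem (every number field, every `p`)

Cell `bsd-f1-sign2`, WIDTH-5 attach seat `bsd-line-att-p4` (gen 3) on line `birth` of crux C2
stmt-BirchSwinnertonDyer-22298 `MainConjectureOfRankZeroBSDAtTwo`; a `--supports 22298 --as helper` file, sequel of
`…FineRoadInfRes` (att-p4 g2: the STRICT source) for the RELAXED sources of skeleton v6. HONEST FRAMING: THEOREMS
ONLY — no definition, no named fact, no `sorry`; BSD is NOT proved by any of this.

WHY. ARCH-NETTING (ii) (lead att-p2 g3; REF1 §62 (ii)): «Kato's modules over `K_∞ = ℚ(ζ_{2^∞})` have no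
archimedean condition (`K_∞` totally imaginary). The restrictions `res : Sel^{rel}(ℚ_∞) → Sel(K_∞)^Δ` and
`res₀ : Sel₀^{rel}(ℚ_∞) → Sel₀(K_∞)^Δ` are DEFINED (no real place upstairs).» In the tree's `Γ_K`-internal model
(`K(μ_{p^∞}) = K̄^{ker χ_p}`, att-p4 g2) this is:

* §1 **`ker_cyclotomicCharacter_inf_decompInf_eq_bot`** — for every number field `K`, prime `p` and infinite place
  `w`: `ker χ_p ⊓ D_w = ⊥`. A non-trivial `σ ∈ Γ_{K_w}` inverts the roots of unity of `K̄`
  (`absGaloisRestrict_smul_eq_inv_of_pow_eq_one_infinitePlace`), while `ker χ_p` fixes the `p`-power ones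
  (`GaloisRep.smul_eq_self_of_cyclotomicCharacter_eq_one`); a primitive `p²`-th root of unity is not its own inverse.
* §2 `infKer_kerCyclotomicCharacter_eq_top`, `localKerOver_kerCyclotomicCharacter_eq_top` — over `K(μ_{p^∞})` BOTH
  archimedean local conditions are vacuous; `strictSelmerGroupOverRelaxedInf_kerCyclotomicCharacter_eq` (relaxed =
  strict upstairs).
* §3 `resOfLe_mem_awayKer` — restriction along `H ≤ H'` preserves "locally trivial above `v`" (any `M`).
* §4 (cyclotomic `κ`) **`resOfLe_relaxedSelmer_mem_selmerGroupOver_kerCyc`**: the finite-place part of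
  `Sel_{p^∞}(E/K_∞^{cyc})` (= `Sel^{rel ∞}`) restricts INTO `Sel_{p^∞}(E/K(μ_{p^∞}))`, with `Δ`-invariant image;
  **`resOfLe_fineRelaxed_mem_strictSelmerGroupOver_kerCyc`**: `Sel₀^{rel ∞}(K_∞^{cyc}, E[p^∞])`
  (`W.fineSelmerInftyRelaxedInf κ`, typer p600292) restricts INTO the fine (= strict, fine data) Selmer group over
  `K(μ_{p^∞})`, with `Δ`-invariant image. Their Pontryagin duals are the maps `fd^{rel}`, `fyʳ` of the netted data
  (att-p3 g3 `…FineRoadArchNettingRel`); the kernels of `res`, `res₀` lie in the finite inf–res kernel of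
  `…FineRoadInfRes` (§2 there, modulo Ribet 1981).

References: R. Greenberg, LNM 1716 (1999) §3 (restriction maps), §4 p. 106; J. S. Milne, *ADT* I Thm. 2.13 (complex
conjugation inverts `μ`); J.-P. Serre, *Abelian ℓ-adic representations* I §1.2; K. Kato, Astérisque 295 §17.13.
-/

set_option autoImplicit false
-- the Theorems namespace of this sub repeats the summit name by design (D-0017 nested layout)
set_option linter.dupNamespace false

noncomputable section

open scoped Classical

namespace Summit.BirchSwinnertonDyer.BirchSwinnertonDyer.Theorems.AlignedTransportAtTwoFineRoad.InfResRel

open WeierstrassCurve NumberField IsDedekindDomain Field Literature.NumberTheory.EllipticCurves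
  Literature.NumberTheory.EllipticCurves.GreenbergSelmer Literature.NumberTheory.GaloisRepresentations ZpExtension

/-! ## §1 `ker χ_p` meets no archimedean decomposition group -/

section KerChi

variable (K : Type) [Field K] [NumberField K] (p : ℕ) [Fact p.Prime]

/-- **`ker χ_p ⊓ D_w = ⊥` for every infinite place `w`** (any number field, any prime `p`): a non-trivial element
of `Γ_{K_w}` inverts every root of unity of `K̄` along the chosen embedding (Milne *ADT* I 2.13, tree
`absGaloisRestrict_smul_eq_inv_of_pow_eq_one_infinitePlace`), while an element of `ker χ_p` fixes the `p`-power roots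
of unity (`GaloisRep.smul_eq_self_of_cyclotomicCharacter_eq_one`); a primitive `p²`-th root of unity `ζ` has
`ζ⁻¹ ≠ ζ`. I.e. `K(μ_{p^∞})` is totally imaginary «at every conjugate of `w`».
[cite: MilneADT2006, Ch. I, Thm. 2.13] -/
theorem ker_cyclotomicCharacter_inf_decompInf_eq_bot (w : InfinitePlace K) :
    (GaloisRep.cyclotomicCharacter K p).toMonoidHom.ker ⊓ decompInf w = ⊥ := by
  have hp : p.Prime := Fact.out
  rw [eq_bot_iff]
  rintro g ⟨hker, ⟨σ, rfl⟩⟩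
  rw [Subgroup.mem_bot]
  by_contra hg
  have hσ : σ ≠ 1 := by
    rintro rfl
    exact hg (map_one _)
  haveI : NeZero ((p ^ 2 : ℕ) : K) := ⟨by exact_mod_cast pow_ne_zero 2 hp.ne_zero⟩
  obtain ⟨ζ, hζ⟩ := HasEnoughRootsOfUnity.exists_primitiveRoot (AlgebraicClosure K) (p ^ 2)
  have h1 : absGaloisRestrict K w.Completion σ • ζ = ζ⁻¹ :=
    absGaloisRestrict_smul_eq_inv_of_pow_eq_one_infinitePlace w hσ (pow_ne_zero 2 hp.ne_zero) hζ.pow_eq_one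
  have h2 : absGaloisRestrict K w.Completion σ • ζ = ζ :=
    GaloisRep.smul_eq_self_of_cyclotomicCharacter_eq_one K p (MonoidHom.mem_ker.1 hker) 2 ζ hζ.pow_eq_one
  have hinv : ζ⁻¹ = ζ := h1.symm.trans h2
  have hζ0 : ζ ≠ 0 := hζ.ne_zero (pow_ne_zero 2 hp.ne_zero)
  have hζ2 : ζ ^ 2 = 1 := by
    rw [pow_two]
    nth_rewrite 2 [← hinv]
    exact mul_inv_cancel₀ hζ0
  have hdvd : p ^ 2 ∣ 2 := (hζ.pow_eq_one_iff_dvd 2).1 hζ2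
  have hle : p ^ 2 ≤ 2 := Nat.le_of_dvd two_pos hdvd
  have h4 : 4 ≤ p ^ 2 := by
    calc 4 = 2 ^ 2 := by norm_num
      _ ≤ p ^ 2 := Nat.pow_le_pow_left hp.two_le 2
  omega

end KerChi

/-! ## §2 Over `K(μ_{p^∞})` both archimedean conditions are vacuous; relaxed = strict upstairs -/

section Upstairs

variable {K : Type} [Field K] [NumberField K] (p : ℕ) [Fact p.Prime]

/-- **«No real place upstairs»**: over `K(μ_{p^∞}) = K̄^{ker χ_p}` the condition "locally trivial at `w ∣ ∞`" on
`H¹(K(μ_{p^∞}), M)` is vacuous for every discrete `Γ_K`-module `M` (`ker χ_p ⊓ D_w = ⊥`, §1, and `H¹(1, M) = 0`).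
[cite: GreenbergLNM1716, §4 (PDF p. 106)] [cite: MilneADT2006, Ch. I, Thm. 2.13] -/
theorem infKer_kerCyclotomicCharacter_eq_top (M : Type) [AddCommGroup M]
    [DistribMulAction (absoluteGaloisGroup K) M] [TopologicalSpace M] [DiscreteTopology M] (w : InfinitePlace K) :
    infKer (GaloisRep.cyclotomicCharacter K p).toMonoidHom.ker M w = ⊤ := by
  rw [eq_top_iff]
  intro c _
  rw [infKer, AddMonoidHom.mem_ker]
  obtain ⟨ψ, hψ⟩ := oneCocycleClass_surjective _
    (resOfLe M (inf_le_left : (GaloisRep.cyclotomicCharacter K p).toMonoidHom.ker ⊓ decompInf w ≤ _) c)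
  rw [← hψ]
  have h0 : ψ = 0 := by
    apply Subtype.ext
    ext x
    have hx : x = 1 := by
      apply Subtype.ext
      have h : (x : absoluteGaloisGroup K) ∈ (⊥ : Subgroup (absoluteGaloisGroup K)) := by
        rw [← ker_cyclotomicCharacter_inf_decompInf_eq_bot K p w]
        exact x.2
      exact Subgroup.mem_bot.mp h
    rw [hx]
    exact contOneCocycles.apply_one ψ
  rw [h0, oneCocycleClass_zero]

/-- Over `K(μ_{p^∞})` the CLASSICAL archimedean Kummer condition on `H¹(K(μ_{p^∞}), E[p^∞])` is vacuous as well
(`FineSelmerLeSelmer.localKerOver_completion_of_mem_infKer`). [cite: GreenbergLNM1716, §4 (PDF p. 106)] -/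
theorem localKerOver_kerCyclotomicCharacter_eq_top (W : WeierstrassCurve K) (w : InfinitePlace K) :
    W.localKerOver p (GaloisRep.cyclotomicCharacter K p).toMonoidHom.ker w.Completion = ⊤ :=
  eq_top_iff.2 fun c _ ↦ FineSelmerLeSelmer.localKerOver_completion_of_mem_infKer W p _ w
    (by rw [infKer_kerCyclotomicCharacter_eq_top]; exact AddSubgroup.mem_top c)

/-- Over `K(μ_{p^∞})` Greenberg's strict Selmer group RELAXED at `∞` EQUALS the strict Selmer group, for every
datum `L` (in particular the fine one): there is nothing to relax. [cite: GreenbergLNM1716, §4 (PDF p. 106)] -/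
theorem strictSelmerGroupOverRelaxedInf_kerCyclotomicCharacter_eq (M : Type) [AddCommGroup M]
    [DistribMulAction (absoluteGaloisGroup K) M] [TopologicalSpace M] [DiscreteTopology M] (L : Data K M p) :
    strictSelmerGroupOverRelaxedInf (GaloisRep.cyclotomicCharacter K p).toMonoidHom.ker M p L =
      strictSelmerGroupOver (GaloisRep.cyclotomicCharacter K p).toMonoidHom.ker M p L :=
  strictSelmerGroupOverRelaxedInf_eq_of_infKer_eq_top _ M p L fun w ↦
    infKer_kerCyclotomicCharacter_eq_top p M w

/-- Membership in `Sel_{p^∞}(E/K(μ_{p^∞}))` is decided by the FINITE places alone (the archimedean Kummer conditions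
are vacuous upstairs). [cite: GreenbergLNM1716, §4 (PDF p. 106)] -/
theorem mem_selmerGroupOver_kerCyclotomicCharacter_iff (W : WeierstrassCurve K)
    (c : W.subgroupH1 p (GaloisRep.cyclotomicCharacter K p).toMonoidHom.ker) :
    c ∈ W.selmerGroupOver p (GaloisRep.cyclotomicCharacter K p).toMonoidHom.ker ↔
      ∀ (v : HeightOneSpectrum (𝓞 K)) (σ : absoluteGaloisGroup K),
        W.conjH1 p _ σ c ∈ W.localKerOver p (GaloisRep.cyclotomicCharacter K p).toMonoidHom.ker
          (v.adicCompletion K) := by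
  rw [WeierstrassCurve.mem_selmerGroupOver_iff]
  exact ⟨fun h ↦ h.1, fun h ↦ ⟨h, fun w σ ↦ by
    rw [localKerOver_kerCyclotomicCharacter_eq_top]; exact AddSubgroup.mem_top _⟩⟩

end Upstairs

/-! ## §3 Restriction preserves "locally trivial above `v`" -/

section Res

variable {K : Type} [Field K] [NumberField K] (M : Type) [AddCommGroup M]
  [DistribMulAction (absoluteGaloisGroup K) M] [TopologicalSpace M] [DiscreteTopology M]

/-- **Restriction along `H ≤ H'` carries `awayKer H' M v` into `awayKer H M v`** (transitivity of restriction: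
`res_{H ⊓ D_v}^{H} ∘ res_{H}^{H'} = res_{H ⊓ D_v}^{H' ⊓ D_v} ∘ res_{H' ⊓ D_v}^{H'}`). [cite: GreenbergLNM1716, §3] -/
theorem resOfLe_mem_awayKer {H H' : Subgroup (absoluteGaloisGroup K)} (h : H ≤ H') (v : HeightOneSpectrum (𝓞 K))
    {c : subgroupH1 H' M} (hc : c ∈ awayKer H' M v) : resOfLe M h c ∈ awayKer H M v := by
  rw [awayKer, AddMonoidHom.mem_ker] at hc ⊢
  have e1 := congrArg (fun f ↦ f c) (resOfLe_comp_holds (M := M) (inf_le_left : H ⊓ decomp v ≤ H) h)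
  have e2 := congrArg (fun f ↦ f c) (resOfLe_comp_holds (M := M)
    (inf_le_inf_right (decomp v) h : H ⊓ decomp v ≤ H' ⊓ decomp v) (inf_le_left : H' ⊓ decomp v ≤ H'))
  simp only [AddMonoidHom.coe_comp, Function.comp_apply] at e1 e2
  rw [e1, ← e2, hc, map_zero]

end Res

/-! ## §4 The relaxed Selmer and fine Selmer groups of `K_∞^{cyc}` restrict into Kato's tower -/

section Cyclotomic

variable {K : Type} [Field K] [NumberField K] {p : ℕ} [Fact p.Prime] (κ : ZpExtension K p)
  (W : WeierstrassCurve K)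

/-- **`res : Sel^{rel ∞}(E/K_∞^{cyc}) → Sel_{p^∞}(E/K(μ_{p^∞}))^Δ` is DEFINED.** For the cyclotomic `ℤ_p`-extension
and a class `c ∈ H¹(K_∞, E[p^∞])` satisfying the classical Kummer conditions at the FINITE places only (the
relaxed-at-`∞` Selmer group of ARCH-NETTING; the finite-place part of `W.selmerGroupOver p (ker κ)`), the restriction
along `ker χ_p ≤ ker κ` lies in `Sel_{p^∞}(E/K(μ_{p^∞}))` (finite places: functoriality `resOfLe_mem_localKerOver`;
infinite places: vacuous upstairs, §2) and is fixed by `conj_σ`, `σ ∈ ker κ` (the `Δ = Gal(K(μ_{p^∞})/K_∞)`-invariants).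
Relaxed companion of `InfRes.resOfLe_selmerInfty_mem_and_conj_eq`. [cite: GreenbergLNM1716, §3 (restriction maps) and §4 (PDF p. 106)] -/
theorem resOfLe_relaxedSelmer_mem_selmerGroupOver_kerCyc (hκ : κ.IsCyclotomic)
    {c : W.subgroupH1 p κ.kerSubgroup}
    (hc : c ∈ ⨅ (v : HeightOneSpectrum (𝓞 K)) (σ : absoluteGaloisGroup K),
      (W.localKerOver p κ.kerSubgroup (v.adicCompletion K)).comap (W.conjH1 p κ.kerSubgroup σ)) :
    W.resOfLe p (InfRes.ker_cyclotomicCharacter_le_kerSubgroup κ hκ) c ∈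
        W.selmerGroupOver p (GaloisRep.cyclotomicCharacter K p).toMonoidHom.ker ∧
      ∀ σ ∈ κ.kerSubgroup,
        W.conjH1 p (GaloisRep.cyclotomicCharacter K p).toMonoidHom.ker σ
            (W.resOfLe p (InfRes.ker_cyclotomicCharacter_le_kerSubgroup κ hκ) c) =
          W.resOfLe p (InfRes.ker_cyclotomicCharacter_le_kerSubgroup κ hκ) c := by
  set h := InfRes.ker_cyclotomicCharacter_le_kerSubgroup κ hκ with hh
  simp only [AddSubgroup.mem_iInf, AddSubgroup.mem_comap] at hc
  refine ⟨?_, fun σ hσ ↦ conjH1_resOfLe_of_mem (M := W.geomPrimaryTorsion p) h hσ c⟩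
  rw [mem_selmerGroupOver_kerCyclotomicCharacter_iff]
  intro v σ
  have hcomm : W.conjH1 p _ σ (W.resOfLe p h c) = W.resOfLe p h (W.conjH1 p κ.kerSubgroup σ c) :=
    (congrArg (fun f ↦ f c) (resOfLe_comp_conjH1_holds (M := geomPrimaryTorsion W p) h σ)).symm
  rw [hcomm]
  exact W.resOfLe_mem_localKerOver p _ h (hc v σ)

/-- **`res₀ : Sel₀^{rel ∞}(K_∞^{cyc}, E[p^∞]) → Sel₀(K(μ_{p^∞}), E[p^∞])^Δ` is DEFINED.** For the cyclotomic
`ℤ_p`-extension and `c ∈ W.fineSelmerInftyRelaxedInf κ` (typer p600292: locally trivial at every FINITE place of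
`K_∞`, nothing at `∞`), the restriction along `ker χ_p ≤ ker κ` lies in Greenberg's strict (= fine-data) Selmer group
over `K(μ_{p^∞})` — locally trivial at all finite places by §3, at the infinite ones vacuously by §2 — and is fixed
by `conj_σ`, `σ ∈ ker κ`. Its Pontryagin dual is the map `fyʳ : X₀(E/K(μ_{p^∞}))_Δ → X₀^{rel ∞}(E/K_∞)` of the netted
data (att-p3 g3). [cite: GreenbergLNM1716, §3 and §4 (PDF p. 106)] [cite: CoatesSujatha2005, §3] -/
theorem resOfLe_fineRelaxed_mem_strictSelmerGroupOver_kerCyc (hκ : κ.IsCyclotomic)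
    {c : W.subgroupH1 p κ.kerSubgroup} (hc : c ∈ W.fineSelmerInftyRelaxedInf κ) :
    W.resOfLe p (InfRes.ker_cyclotomicCharacter_le_kerSubgroup κ hκ) c ∈
        strictSelmerGroupOver (GaloisRep.cyclotomicCharacter K p).toMonoidHom.ker (W.geomPrimaryTorsion p) p
          (fineData (W.geomPrimaryTorsion p) p) ∧
      ∀ σ ∈ κ.kerSubgroup,
        W.conjH1 p (GaloisRep.cyclotomicCharacter K p).toMonoidHom.ker σ
            (W.resOfLe p (InfRes.ker_cyclotomicCharacter_le_kerSubgroup κ hκ) c) =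
          W.resOfLe p (InfRes.ker_cyclotomicCharacter_le_kerSubgroup κ hκ) c := by
  set h := InfRes.ker_cyclotomicCharacter_le_kerSubgroup κ hκ with hh
  have hc' := (mem_strictSelmerGroupOverRelaxedInf_iff (H := κ.kerSubgroup) (M := W.geomPrimaryTorsion p)
    (L := fineData (W.geomPrimaryTorsion p) p) c).1 hc
  refine ⟨?_, fun σ hσ ↦ conjH1_resOfLe_of_mem (M := W.geomPrimaryTorsion p) h hσ c⟩
  have hcomm : ∀ σ : absoluteGaloisGroup K,
      W.conjH1 p _ σ (W.resOfLe p h c) = W.resOfLe p h (W.conjH1 p κ.kerSubgroup σ c) := fun σ ↦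
    (congrArg (fun f ↦ f c) (resOfLe_comp_conjH1_holds (M := geomPrimaryTorsion W p) h σ)).symm
  refine (mem_strictSelmerGroupOver_iff (H := (GaloisRep.cyclotomicCharacter K p).toMonoidHom.ker)
    (M := W.geomPrimaryTorsion p) (L := fineData (W.geomPrimaryTorsion p) p) _).2
    ⟨fun v hv σ ↦ ?_, fun w σ ↦ ?_, fun v hv σ ↦ ?_⟩
  · rw [hcomm]
    exact resOfLe_mem_awayKer (W.geomPrimaryTorsion p) h v (hc'.1 v hv σ)
  · rw [infKer_kerCyclotomicCharacter_eq_top]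
    exact AddSubgroup.mem_top _
  · change _ ∈ (fineLocalDatum (W.geomPrimaryTorsion p) v).strictKer _
    rw [LocalAway.strictKer_fineLocalDatum_eq_awayKer, hcomm]
    have h2 := hc'.2 v hv σ
    change _ ∈ (fineLocalDatum (W.geomPrimaryTorsion p) v).strictKer _ at h2
    rw [LocalAway.strictKer_fineLocalDatum_eq_awayKer] at h2
    exact resOfLe_mem_awayKer (W.geomPrimaryTorsion p) h v h2

end Cyclotomic

end Summit.BirchSwinnertonDyer.BirchSwinnertonDyer.Theorems.AlignedTransportAtTwoFineRoad.InfResRel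

end
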